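import Mathlib
import Literature.MathematicalPhysics.QuantumFieldTheory.Balaban1983to89.B12SmallFieldRegion255

/-!
# `Balaban1983to89.B12Average012Covariance` — [Balaban1987RG1] p. 254 «This average has properties similar to the
# properties of the average introduced in (0.4)» and p. 265 «The gauge covariance of the averages implies that the
# δ-functions in (2.1) are invariant under the gauge transformations V → V^v, W → W^v» — the GAUGE COVARIANCE
# `Ū^g(c) = g(L c₋) Ū(c) g(L c₊)⁻¹` ([B7] (11) «\overline{U^u} = (Ū)^u») PROVED for the average (0.12) built from the
# averaged contour variables (0.11) on the b12 lineage's `ℤᵈ` corner-cube geometry, with its consequences for the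
# `δ`-functions / the coupling `|Ū − V| < ε₀`, for the small field region of p. 255, and for the variables
# `V = V′V⁽ᵏ⁾`, `B′ = (1/i) log V′` of p. 265 («induces … the transformation B′ → R(v)B′»; covariance of `Q̃` in (2.4))

HONEST FRAMING (cell `lit-balaban`, verbatim): statement-level skeleton of published theorems with citation tags;
proofs where landed; nothing here is a claim about the Yang–Mills mass gap.

CITATION HEADER.  T. Bałaban, *Renormalization group approach to lattice gauge field theories. I. Generation of
effective actions in a small field approximation and a coupling constant renormalization in four dimensions*,
Commun. Math. Phys. **109** (1987) 249–301, doi:10.1007/bf01215223 [Balaban1987RG1] (cell paper B12).  PDF held: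
`paper:balaban1987-cmp109-rg-i-small-field` (journal page = PDF page + 248); pp. 253–254, 265–266, 269 [PDF 5–6, 17–18,
21] re-read this generation from the held text (p. 255 also from the render `…-p007-x2.png`, read as an image).
[B7] = [Balaban1985Averaging] T. Bałaban, *Averaging operations for lattice gauge theories*, Commun. Math. Phys. **98**
(1985) 17–51: (8) p. 18, (11) p. 19, p. 24 (after (43)), (45) p. 24 — quoted from the tree module
`B7AvgGaugeCovariance` (which READ them as images) and used here only as the shape of the statements; the tree
proves (11) for the [B7] averages (42)/(43) (`B7Prop1Explicit.bavg_gaugeAct`, `B7AvgGaugeCovariance.avgIter_gaugeAct`)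
— NOT for the (0.12)/(0.11) average of [I], which is what this file does.  Unit `lit-balaban-r09` gen 9 (display
owner of CMP 109; TAKING line `HOME/STATUS.md` 2026-08-21T07:18:44Z), HOME `run/shared/lean/pub/lit-balaban/`;
SKELETON rows `B12.Eq0.12` (D + C: «properties similar …»), `B12.Eq2.1` (the gauge clause of p. 265),
`B12.Eq2.4`, `B12.Eq0.16` (the small field region, `B12SmallFieldRegion255`).

WHAT IS PRINTED (verbatim).  p. 253: *«M({u𝐔_jv}) = uM({𝐔_j})v; (0.6)»*.  p. 254: *«Ū(c) = exp[i Σ_{x∈B(c₋)} L⁻ᵈ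
(1/i) log 𝐔(c₋, x)𝐔([x, x′])𝐔(x′, c₊)𝐔(−c)] 𝐔(c). (0.12)  This average has properties similar to the properties of
the average introduced in (0.4), especially all results of the paper [12] are valid for it.»* … *«If ρ is a gauge
invariant function, then Tρ is gauge invariant also.»*  p. 265: *«The gauge covariance of the averages implies that
the δ-functions in (2.1) are invariant under the gauge transformations V → V^v, W → W^v, because δ(U) is invariant
under the transformations U → R(u)U, u ∈ G.»* … *«We introduce new integration variables V′ = V(V⁽ᵏ⁾)⁻¹, or V = V′V⁽ᵏ⁾,
and we assume that the characteristic function χ_k and the δ-functions in (2.1) restrict the variables B′ = (1/i)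
log V′ to a sufficiently small neighborhood of 0. A gauge transformation v of V induces the gauge transformation v
of V⁽ᵏ⁾ and the transformation B′ → R(v)B′. The expressions in (2.1) are invariant with respect to these
transformations.»*  p. 266, (2.4): *«M(V′V⁽ᵏ⁾)(M(V⁽ᵏ⁾))⁻¹ = exp iQ̃(B′).»*  p. 269, (2.16): *«(R(u)B′)(b) =
R(u(b₋))B′(b)»*.  [B7] p. 19, (11): *«(\overline{U^u})(y, y′) = u(y)Ū(y, y′)u⁻¹(y′), or \overline{U^u} = (Ū)^u»*;
p. 24: *«thus the matrices U^u(Γ_{c,x})U^u(c)⁻¹ and U(Γ_{c,x})U(c)⁻¹ are unitarily equivalent, their eigenvalues are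
equal, and by the definition (22) their logarithms are unitarily equivalent with the same unitary operator u(c₋).
Then from (42) we get (\overline{U^u})_c = u(c₋)Ū_c u⁻¹(c₊).»*

DICTIONARY print → Lean (objects PRE-EXISTING; the only new definition is the adjoint action `rotB` of (2.16) on
`𝔸`-valued bond fields).  Fine lattice `ℤᵈ`, bonds `ZdEdge d`, corner cubes `B(y) = L·y + {0,…,L−1}ᵈ` with base
`L·y = blockBase L y`; gauge transformation `U^g` ↦ the tree's `QuantumLattice.gaugeTransformZd g U`
(`= B7Prop1Explicit.gaugeAct g` on the curried configuration, `curry_gaugeTransformZd`); the induced coarse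
transformation «V → V^v» ↦ `gaugeTransformZd (g ∘ blockBase L) V` (`v(y) = g(L y)`), and conversely a coarse `v` acts
on the fine lattice block-constantly through `v ∘ blockMap L`; `G`-valued ↦ `U1 𝔸`-valued (‖u‖, ‖u⁻¹‖ ≤ 1) in a
complete normed `ℂ`-algebra with `‖1‖ = 1`; (0.11) `𝐔(q,x)` ↦ `B12ContourAverage253.Tavg`; (0.12) `Ū(c)` ↦
`B12SmallFieldRegion255.avgBar L U c = B12AverageCorridor267.avgM L (Tavg L) U c`; `V′V⁽ᵏ⁾` with `V′ = exp(iB′)` ↦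
`B12AverageCorridor267.pert B′ V⁽ᵏ⁾`; `Q̃` of (2.4) ↦ `B12AverageCorridor267.Qtilde`; `R(v)B′` ↦ `rotB v B′`.

WHAT IS PROVED (kernel-checked, no `sorry`, standard axioms; no `Prop` placeholder, net new unproved facts 0).
§ 1 `curry_gaugeTransformZd`, `lineR_gaugeTransformZd`, `Ustr_gaugeTransformZd` ((8) along straight segments; the
factor `U(c)` of (0.12)).  § 2 `Tavg_gaugeTransformZd` ((0.6) ⇒ `𝐔^g(q,x) = g(q)𝐔(q,x)g(x)⁻¹`, from the lineage's
`fedAvg_mul_mul`), `loopW_Tavg_gaugeTransformZd` (the (0.12) loops are conjugated by `g(L c₋)` — [B7] p. 24's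
sentence for the (0.11) variables), `avgBar_eq_expU_mul_Ustr`, `Yexp_gaugeTransformZd` («their logarithms are
unitarily equivalent with the same unitary operator», on the domain `‖W − 1‖ < 1` of the tree's logarithmic series,
`B7Prop1Explicit.mlog_units_conj`), `expU_conj`.  § 3 **`avgBar_gaugeTransformZd_of_loops`** ((11) for (0.12)/(0.11)
whenever the off-axis loops lie in the log domain) and **`avgBar_gaugeTransformZd`** (the same under print's plaquette
regularity `‖U(∂p) − 1‖ ≤ ε₀`, `(dL)²ε₀ ≤ 1/100`, via `B12ContourAverage253.norm_loopW_Tavg_sub_one_le`).  § 4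
`norm_plaq_gaugeTransformZd_sub_one_le` ([B7] (45)), **`norm_avgBar_gaugeTransformZd_sub_le`** /
`avgBar_gaugeTransformZd_eq_of_eq` (p. 265: the `δ`-function `Ū = V` and the coupling `‖Ū − V‖` are preserved under
`(U, V) ↦ (U^g, V^{g∘(L·)})`), **`gaugeTransformZd_mem_smallFieldRegion`** (the small field region of p. 255 is mapped
into the region of `V^v` by the block-constant lift `v ∘ ⌊·/L⌋` of any `U1`-valued coarse `v`).  § 5
**`gaugeTransformZd_pert`** (p. 265: `(V′V⁽ᵏ⁾)^v = exp(iR(v)B′)·(V⁽ᵏ⁾)^v` — transforming `V` IS transforming `V⁽ᵏ⁾` and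
`B′ → R(v)B′`), **`Qtilde_gaugeTransformZd`** (covariance of (2.4): `Q̃_{(V⁽ᵏ⁾)^v}(R(v)B′)(c) = v(L c₋)Q̃_{V⁽ᵏ⁾}(B′)(c)
v(L c₋)⁻¹` on the log domains).

DIVERGENCES / NOT PROVED (honest scope).  (a) Geometry and objects of the b12 lineage (`ℤᵈ`, corner cubes,
Federbush's (0.10) via the tree's local solution; `B12ContourAverage253` DIVERGENCE D-b12g23.1 inherited); the
logarithm of (0.12)/(2.4) is the tree's series `MatrixLog.mlog`, whence the explicit log-domain hypotheses
(`‖W − 1‖ < 1`), discharged from plaquette regularity where the lineage has the estimate (§ 3) and kept as printed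
(«B′ … a sufficiently small neighborhood of 0») in § 5.  (b) «all results of the paper [12] are valid for it» (p. 254)
is NOT proved here beyond (11)/(45): Propositions 1–3 of [12] for the (0.12)/(0.11) average remain untyped (the tree
has them for the [12] averages: `B7Prop1Explicit`, `B7Prop2Explicit`, `B12Prop2Claims260`).  (c) The invariance of the
OTHER expressions in (2.1) (`G(V)`, `A(U_k(V))`, `E_k`, `χ_k`) is the tree's `B12RTGaugeInvariance254` /
`B12GaugeFixInvariance269` / `B12ChiInvariance269` (torus side) and is not re-derived on `ℤᵈ`.
-/

noncomputable section

open NormedSpace Finset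

namespace Literature.MathematicalPhysics.QuantumFieldTheory.Balaban1983to89.B12Average012Covariance

open Literature.MathematicalPhysics.QuantumLattice (ZdEdge blockMap blockBase blockSites mem_blockSites_iff
  plaquetteHolonomyZd gaugeTransformZd plaquetteHolonomyZd_gaugeTransformZd)
open B7Eq61Linearization (lineR)
open B7Prop1Explicit (e seg hol hol_gaugeAct disp disp_seg gaugeAct U1 mem_U1 hol_mem norm_units_conj_sub_one_le
  mlog_units_conj)
open B12HOperator267 (gammaT)
open B12AverageCorridor267 (Ustr loopW loopW_def loopW_axisSite avgM expU val_expU val_inv_expU offAxis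
  sum_blockSites_eq Yexp mem_blockSites_of_mem_offAxis add_mem_blockSites_succ blockBase_add_single exp_conj_units)
open B12PlaquetteLoop267 (zsmul_e hol_seg_eq_lineR)
open B12ContourAverage253 (permWord disp_permWord permT permT_eq_of_mem Tavg fedAvg fedAvg_mul_mul
  isAxisStraightFamily_Tavg omegaA omegaA_nonneg norm_loopW_Tavg_sub_one_le)
open B12SmallFieldRegion255 (avgBar smallFieldRegion)
open MatrixLog (mlog mlog_one)

variable {d : ℕ}

/-! ## § 1  The gauge action on `ℤᵈ` in the word calculus; covariance of straight transporters -/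

section Transport

variable {G : Type*} [Group G] {L : ℕ}

/-- [cite: Balaban1985Averaging, (8) p.18] the tree's uncurried gauge action `QuantumLattice.gaugeTransformZd`
(`U(x,i) ↦ g(x)U(x,i)g(x+eᵢ)⁻¹`) IS [B7] (8) `B7Prop1Explicit.gaugeAct` on the curried configuration. -/
theorem curry_gaugeTransformZd (g : (Fin d → ℤ) → G) (U : ZdEdge d → G) :
    Function.curry (gaugeTransformZd g U) = gaugeAct g (Function.curry U) := rfl

/-- [cite: Balaban1985Averaging, (8) p.18] (8) along a straight segment: `U^g([x, x + n e_μ]) =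
g(x) U([x, x + n e_μ]) g(x + n e_μ)⁻¹` (`B7Prop1Explicit.hol_gaugeAct` through `hol_seg_eq_lineR`). -/
theorem lineR_gaugeTransformZd (g : (Fin d → ℤ) → G) (U : ZdEdge d → G) (x : Fin d → ℤ) (μ : Fin d) (n : ℕ) :
    lineR (gaugeTransformZd g U) x μ n = g x * lineR U x μ n * (g (x + Pi.single μ (n : ℤ)))⁻¹ := by
  rw [← hol_seg_eq_lineR, ← hol_seg_eq_lineR, curry_gaugeTransformZd, hol_gaugeAct, disp_seg, zsmul_e]

/-- [cite: Balaban1987RG1, (0.12) p.254] the factor `U(c)` of (0.12) transforms as `U^g(c) = g(L c₋) U(c) g(L c₊)⁻¹`. -/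
theorem Ustr_gaugeTransformZd (g : (Fin d → ℤ) → G) (U : ZdEdge d → G) (c : ZdEdge d) :
    Ustr L (gaugeTransformZd g U) c =
      g (blockBase L c.1) * Ustr L U c * (g (blockBase L (c.1 + Pi.single c.2 1)))⁻¹ := by
  unfold Ustr
  rw [lineR_gaugeTransformZd, blockBase_add_single]

end Transport

/-! ## § 2  (0.6) ⇒ covariance of the averaged contour variables (0.11) and of the (0.12) loops -/

section Loops

variable {𝔸 : Type*} [NormedRing 𝔸] [NormedAlgebra ℂ 𝔸] [NormOneClass 𝔸] [CompleteSpace 𝔸] {L : ℕ}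

/-- [cite: Balaban1987RG1, (0.11) p.253] **COVARIANCE OF THE AVERAGED CONTOUR VARIABLES**:
`𝐔^g(q, x) = g(q) 𝐔(q, x) g(x)⁻¹` for `x ∈ B(y)`, `q = L y`, whenever `g(q) ∈ U1` — (0.6) for the contour family
`𝐆(q,x)` (`B12ContourAverage253.fedAvg_mul_mul`; every contour runs from `q` to `x`). -/
theorem Tavg_gaugeTransformZd (hL : 0 < L) (U : ZdEdge d → 𝔸ˣ) {g : (Fin d → ℤ) → 𝔸ˣ} {y x : Fin d → ℤ}
    (hx : x ∈ blockSites L y) (hg : g (blockBase L y) ∈ U1 𝔸) :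
    Tavg L (gaugeTransformZd g U) x = g (blockBase L y) * Tavg L U x * (g x)⁻¹ := by
  unfold Tavg
  have h : (fun π : Equiv.Perm (Fin d) => permT L (gaugeTransformZd g U) π x)
      = fun π => g (blockBase L y) * permT L U π x * (g x)⁻¹ := by
    funext π
    rw [permT_eq_of_mem hL _ hx, permT_eq_of_mem hL _ hx, curry_gaugeTransformZd, hol_gaugeAct, disp_permWord,
      add_sub_cancel]
  rw [h]
  exact fedAvg_mul_mul hg _ _ 1

/-- [cite: Balaban1987RG1, (0.12) p.254] **THE (0.12) LOOPS ARE CONJUGATED AT THE BASE POINT**: for `x ∈ B(c₋)`,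
`W_x(U^g) = g(L c₋) W_x(U) g(L c₋)⁻¹` (the four covariances of `𝐔(c₋,x)`, `U([x,x′])`, `𝐔(c₊,x′)`, `U(c)` telescope;
cf. [B7] p. 24 «U^u(Γ_{c,x})U^u(c)⁻¹ = u(c₋)U(Γ_{c,x})U(c)⁻¹u⁻¹(c₋)»). -/
theorem loopW_Tavg_gaugeTransformZd (hL : 0 < L) (U : ZdEdge d → 𝔸ˣ) {g : (Fin d → ℤ) → 𝔸ˣ}
    (hg : ∀ z, g z ∈ U1 𝔸) (c : ZdEdge d) {x : Fin d → ℤ} (hx : x ∈ blockSites L c.1) :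
    loopW L (fun U : ZdEdge d → 𝔸ˣ => Tavg L U) (gaugeTransformZd g U) c x
      = g (blockBase L c.1) * loopW L (fun U : ZdEdge d → 𝔸ˣ => Tavg L U) U c x * (g (blockBase L c.1))⁻¹ := by
  have hx' : x + Pi.single c.2 (L : ℤ) ∈ blockSites L (c.1 + Pi.single c.2 1) := add_mem_blockSites_succ hL c.2 hx
  rw [loopW_def, loopW_def, Tavg_gaugeTransformZd hL U hx (hg _), Tavg_gaugeTransformZd hL U hx' (hg _),
    lineR_gaugeTransformZd, Ustr_gaugeTransformZd, blockBase_add_single]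
  group

omit [NormOneClass 𝔸] in
/-- [cite: Balaban1987RG1, (0.12) p.254] the average (0.12) over the (0.11) variables in exponent form:
`Ū(c) = exp[Y(c)] · U(c)` with `Y(c)` the sum of the off-axis logarithms (axis loops are `1`). -/
theorem avgBar_eq_expU_mul_Ustr (hL : 0 < L) (U : ZdEdge d → 𝔸ˣ) (c : ZdEdge d) :
    avgBar L U c = expU (Yexp L (fun U : ZdEdge d → 𝔸ˣ => Tavg L U) U c) * Ustr L U c := by
  unfold avgBar avgM
  rw [sum_blockSites_eq hL c, sum_eq_zero fun l hl => ?_, zero_add]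
  · rfl
  · rw [loopW_axisSite (isAxisStraightFamily_Tavg hL) U c (mem_range.1 hl), Units.val_one, mlog_one, smul_zero]

/-- [cite: Balaban1985Averaging, p.24] «their logarithms are unitarily equivalent with the same unitary operator
u(c₋)»: the exponent of (0.12) is conjugated, `Y(c)[U^g] = g(L c₋) Y(c)[U] g(L c₋)⁻¹`, provided every off-axis
loop lies in the domain `‖W_x(U) − 1‖ < 1` of the logarithmic series (`B7Prop1Explicit.mlog_units_conj`). -/
theorem Yexp_gaugeTransformZd (hL : 0 < L) (U : ZdEdge d → 𝔸ˣ) {g : (Fin d → ℤ) → 𝔸ˣ} (hg : ∀ z, g z ∈ U1 𝔸)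
    (c : ZdEdge d)
    (hW : ∀ x ∈ offAxis L c, ‖((loopW L (fun U : ZdEdge d → 𝔸ˣ => Tavg L U) U c x : 𝔸ˣ) : 𝔸) - 1‖ < 1) :
    Yexp L (fun U : ZdEdge d → 𝔸ˣ => Tavg L U) (gaugeTransformZd g U) c
      = (g (blockBase L c.1) : 𝔸) * Yexp L (fun U : ZdEdge d → 𝔸ˣ => Tavg L U) U c
          * (((g (blockBase L c.1))⁻¹ : 𝔸ˣ) : 𝔸) := by
  unfold Yexp
  rw [mul_sum, sum_mul]
  refine sum_congr rfl fun x hx => ?_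
  rw [loopW_Tavg_gaugeTransformZd hL U hg c (mem_blockSites_of_mem_offAxis hx), Units.val_mul, Units.val_mul,
    mlog_units_conj (hg _) (hW x hx), mul_smul_comm, smul_mul_assoc]

omit [NormOneClass 𝔸] in
/-- [folklore] conjugating the exponent conjugates the exponential, as units (`NormedSpace.exp_units_conj`). -/
private theorem expU_conj (P : 𝔸ˣ) (a : 𝔸) : expU ((P : 𝔸) * a * ((P⁻¹ : 𝔸ˣ) : 𝔸)) = P * expU a * P⁻¹ :=
  Units.ext (by rw [val_expU, exp_conj_units, Units.val_mul, Units.val_mul, val_expU])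

end Loops

/-! ## § 3  The covariance of the average (0.12) over the (0.11) variables -/

section Covariance

variable {𝔸 : Type*} [NormedRing 𝔸] [NormedAlgebra ℂ 𝔸] [NormOneClass 𝔸] [CompleteSpace 𝔸] {L : ℕ}

/-- **[B7] (11) «\overline{U^u} = (Ū)^u» FOR THE AVERAGE (0.12) OF [Balaban1987RG1] BUILT FROM THE AVERAGED
CONTOUR VARIABLES (0.11)** (p. 254 «This average has properties similar to the properties of the average introduced
in (0.4)»): `Ū^g(c) = g(L c₋) · Ū(c) · g(L c₊)⁻¹` for every gauge function `g` with values in `U1` and every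
configuration whose off-axis (0.12) loops satisfy `‖W_x(U) − 1‖ < 1` (the domain of the logarithm in (0.12)).
[cite: Balaban1987RG1, (0.12) p.254] -/
theorem avgBar_gaugeTransformZd_of_loops (hL : 0 < L) (U : ZdEdge d → 𝔸ˣ) {g : (Fin d → ℤ) → 𝔸ˣ}
    (hg : ∀ z, g z ∈ U1 𝔸) (c : ZdEdge d)
    (hW : ∀ x ∈ offAxis L c, ‖((loopW L (fun U : ZdEdge d → 𝔸ˣ => Tavg L U) U c x : 𝔸ˣ) : 𝔸) - 1‖ < 1) :
    avgBar L (gaugeTransformZd g U) c =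
      g (blockBase L c.1) * avgBar L U c * (g (blockBase L (c.1 + Pi.single c.2 1)))⁻¹ := by
  rw [avgBar_eq_expU_mul_Ustr hL, avgBar_eq_expU_mul_Ustr hL, Yexp_gaugeTransformZd hL U hg c hW, expU_conj,
    Ustr_gaugeTransformZd]
  group

/-- **THE SAME UNDER PRINT'S PLAQUETTE REGULARITY** «|U(∂p) − 1| < ε₀, p ∈ T» (p. 254): for `U1`-valued `U`, `g`,
`(dL)²ε₀ ≤ 1/100` and `d ≥ 1` the off-axis loops are within `ω_A(ε₀) = 10(dL)²ε₀ ≤ 1/10` of `1`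
(`B12ContourAverage253.norm_loopW_Tavg_sub_one_le`), so `Ū^g(c) = g(L c₋) Ū(c) g(L c₊)⁻¹` for every coarse bond.
[cite: Balaban1987RG1, (0.12) p.254] -/
theorem avgBar_gaugeTransformZd (hL : 0 < L) (hd : 1 ≤ d) (U : ZdEdge d → 𝔸ˣ) (hU : ∀ b, U b ∈ U1 𝔸)
    {g : (Fin d → ℤ) → 𝔸ˣ} (hg : ∀ z, g z ∈ U1 𝔸) {ε₀ : ℝ} (hε₀ : 0 ≤ ε₀)
    (hsm : ((d : ℝ) * L) ^ 2 * ε₀ ≤ 1 / 100)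
    (h44 : ∀ (p : Fin d → ℤ) (i j : Fin d), i ≠ j → ‖((plaquetteHolonomyZd U p i j : 𝔸ˣ) : 𝔸) - 1‖ ≤ ε₀)
    (c : ZdEdge d) :
    avgBar L (gaugeTransformZd g U) c =
      g (blockBase L c.1) * avgBar L U c * (g (blockBase L (c.1 + Pi.single c.2 1)))⁻¹ := by
  refine avgBar_gaugeTransformZd_of_loops hL U hg c fun x hx => ?_
  have h := norm_loopW_Tavg_sub_one_le hL hd U (fun b => (mem_U1.mp (hU b)).1) (fun b => (mem_U1.mp (hU b)).2)
    hε₀ hsm h44 c x hx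
  have hω : omegaA d L ε₀ ≤ 1 / 10 := by unfold omegaA; linarith
  linarith

end Covariance

/-! ## § 4  Consequences for the restrictions of pp. 254–255 (p. 265 «The gauge covariance of the averages implies
that the δ-functions in (2.1) are invariant under the gauge transformations V → V^v, W → W^v») -/

section Region

variable {𝔸 : Type*} [NormedRing 𝔸] [NormedAlgebra ℂ 𝔸] [NormOneClass 𝔸] [CompleteSpace 𝔸] {L : ℕ}

omit [NormedAlgebra ℂ 𝔸] [CompleteSpace 𝔸] in
/-- [cite: Balaban1985Averaging, (45) p.24] «|V₀(∂p) − 1| = |V(∂p) − 1|»: plaquette regularity is gauge invariant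
(`U1`-valued gauge functions; here as `≤`, the reverse inequality being the same statement for `g⁻¹`). -/
theorem norm_plaq_gaugeTransformZd_sub_one_le (U : ZdEdge d → 𝔸ˣ) {g : (Fin d → ℤ) → 𝔸ˣ}
    (hg : ∀ z, g z ∈ U1 𝔸) (p : Fin d → ℤ) (i j : Fin d) :
    ‖((plaquetteHolonomyZd (gaugeTransformZd g U) p i j : 𝔸ˣ) : 𝔸) - 1‖
      ≤ ‖((plaquetteHolonomyZd U p i j : 𝔸ˣ) : 𝔸) - 1‖ := by
  rw [plaquetteHolonomyZd_gaugeTransformZd, Units.val_mul, Units.val_mul]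
  exact norm_units_conj_sub_one_le (hg p) _

omit [NormedAlgebra ℂ 𝔸] [CompleteSpace 𝔸] in
/-- [folklore] `‖g X g′⁻¹ − g Y g′⁻¹‖ ≤ ‖X − Y‖` for `g, g′ ∈ U1`. -/
private theorem norm_conj₂_sub_le {g g' : 𝔸ˣ} (hg : g ∈ U1 𝔸) (hg' : g' ∈ U1 𝔸) (X Y : 𝔸) :
    ‖(g : 𝔸) * X * ((g'⁻¹ : 𝔸ˣ) : 𝔸) - (g : 𝔸) * Y * ((g'⁻¹ : 𝔸ˣ) : 𝔸)‖ ≤ ‖X - Y‖ := by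
  have h : (g : 𝔸) * X * ((g'⁻¹ : 𝔸ˣ) : 𝔸) - (g : 𝔸) * Y * ((g'⁻¹ : 𝔸ˣ) : 𝔸)
      = (g : 𝔸) * (X - Y) * ((g'⁻¹ : 𝔸ˣ) : 𝔸) := by noncomm_ring
  rw [h]
  calc ‖(g : 𝔸) * (X - Y) * ((g'⁻¹ : 𝔸ˣ) : 𝔸)‖ ≤ ‖(g : 𝔸)‖ * ‖X - Y‖ * ‖((g'⁻¹ : 𝔸ˣ) : 𝔸)‖ := by
        refine (norm_mul_le _ _).trans (mul_le_mul_of_nonneg_right (norm_mul_le _ _) (norm_nonneg _))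
    _ ≤ 1 * ‖X - Y‖ * 1 := by
        gcongr
        · exact (mem_U1.mp hg).1
        · exact (mem_U1.mp hg').2
    _ = ‖X - Y‖ := by ring

/-- **p. 265, THE `δ`-FUNCTION / COUPLING CLAUSE FOR THE CONCRETE AVERAGE**: the gauge function `g` of the fine
lattice induces `v = g ∘ (L·)` on the coarse lattice, and `‖Ū^g(c) − V^v(c)‖ ≤ ‖Ū(c) − V(c)‖` — so the equality
`Ū = V` («the equalities Ū = V», the `δ`-functions of (0.17)/(2.1)) and the coupling «|Ū − V| < ε₀» of p. 254 are
preserved under `(U, V) ↦ (U^g, V^v)` (print: «The gauge covariance of the averages implies that the δ-functions in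
(2.1) are invariant under the gauge transformations V → V^v, W → W^v»). [cite: Balaban1987RG1, (2.1) p.265] -/
theorem norm_avgBar_gaugeTransformZd_sub_le (hL : 0 < L) (hd : 1 ≤ d) (U : ZdEdge d → 𝔸ˣ)
    (hU : ∀ b, U b ∈ U1 𝔸) {g : (Fin d → ℤ) → 𝔸ˣ} (hg : ∀ z, g z ∈ U1 𝔸) {ε₀ : ℝ} (hε₀ : 0 ≤ ε₀)
    (hsm : ((d : ℝ) * L) ^ 2 * ε₀ ≤ 1 / 100)
    (h44 : ∀ (p : Fin d → ℤ) (i j : Fin d), i ≠ j → ‖((plaquetteHolonomyZd U p i j : 𝔸ˣ) : 𝔸) - 1‖ ≤ ε₀)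
    (V : ZdEdge d → 𝔸ˣ) (c : ZdEdge d) :
    ‖((avgBar L (gaugeTransformZd g U) c : 𝔸ˣ) : 𝔸) - ((gaugeTransformZd (g ∘ blockBase L) V c : 𝔸ˣ) : 𝔸)‖
      ≤ ‖((avgBar L U c : 𝔸ˣ) : 𝔸) - (V c : 𝔸)‖ := by
  rw [avgBar_gaugeTransformZd hL hd U hU hg hε₀ hsm h44 c, Units.val_mul, Units.val_mul]
  simp only [gaugeTransformZd, Function.comp_apply, Units.val_mul]
  exact norm_conj₂_sub_le (hg _) (hg _) _ _

/-- The `δ`-function form: `Ū(c) = V(c)` implies `Ū^g(c) = V^v(c)`, `v = g ∘ (L·)`.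
[cite: Balaban1987RG1, (2.1) p.265] -/
theorem avgBar_gaugeTransformZd_eq_of_eq (hL : 0 < L) (hd : 1 ≤ d) (U : ZdEdge d → 𝔸ˣ)
    (hU : ∀ b, U b ∈ U1 𝔸) {g : (Fin d → ℤ) → 𝔸ˣ} (hg : ∀ z, g z ∈ U1 𝔸) {ε₀ : ℝ} (hε₀ : 0 ≤ ε₀)
    (hsm : ((d : ℝ) * L) ^ 2 * ε₀ ≤ 1 / 100)
    (h44 : ∀ (p : Fin d → ℤ) (i j : Fin d), i ≠ j → ‖((plaquetteHolonomyZd U p i j : 𝔸ˣ) : 𝔸) - 1‖ ≤ ε₀)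
    {V : ZdEdge d → 𝔸ˣ} {c : ZdEdge d} (hδ : avgBar L U c = V c) :
    avgBar L (gaugeTransformZd g U) c = gaugeTransformZd (g ∘ blockBase L) V c := by
  rw [avgBar_gaugeTransformZd hL hd U hU hg hε₀ hsm h44 c, hδ]
  rfl

/-- **THE SMALL FIELD REGION OF P. 255 UNDER BLOCK-CONSTANT GAUGE TRANSFORMATIONS**: for `v` on the coarse lattice
with values in `U1`, the lift `g = v ∘ ⌊·/L⌋` (constant on every block) maps the region of `V` into the region of
`V^v` — plaquette regularity is invariant, the (0.16) restriction `‖𝐔(q,x) − 1‖` is invariant because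
`𝐔^g(q,x) = v(y)𝐔(q,x)v(y)⁻¹`, and the coupling by `norm_avgBar_gaugeTransformZd_sub_le`; the residual gauge freedom
left by (0.16) is thus the coarse one, as on p. 254 («we consider Tρ on configurations V … If ρ is a gauge
invariant function, then Tρ is gauge invariant also»). [cite: Balaban1987RG1, p.255] -/
theorem gaugeTransformZd_mem_smallFieldRegion (hL : 0 < L) (hd : 1 ≤ d) {ε₀ : ℝ} (hε₀ : 0 ≤ ε₀)
    (hsm : ((d : ℝ) * L) ^ 2 * ε₀ ≤ 1 / 100) {V U : ZdEdge d → 𝔸ˣ} (hU : ∀ b, U b ∈ U1 𝔸)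
    (hmem : U ∈ smallFieldRegion L ε₀ V) {v : (Fin d → ℤ) → 𝔸ˣ} (hv : ∀ y, v y ∈ U1 𝔸) :
    gaugeTransformZd (v ∘ blockMap L) U ∈ smallFieldRegion L ε₀ (gaugeTransformZd v V) := by
  haveI : NeZero L := ⟨hL.ne'⟩
  obtain ⟨h44, hgf, hV⟩ := hmem
  have hg : ∀ z, (v ∘ blockMap L) z ∈ U1 𝔸 := fun z => hv _
  refine ⟨fun p i j hij => (norm_plaq_gaugeTransformZd_sub_one_le U hg p i j).trans (h44 p i j hij),
    fun y x hx hxq => ?_, fun c => ?_⟩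
  · have hy : blockMap L x = y := (mem_blockSites_iff L y x).1 hx
    rw [Tavg_gaugeTransformZd hL U hx (hg _), Units.val_mul, Units.val_mul]
    simp only [Function.comp_apply, Literature.MathematicalPhysics.QuantumLattice.blockMap_blockBase, hy]
    exact (norm_units_conj_sub_one_le (hv y) _).trans (hgf y x hx hxq)
  · have h := norm_avgBar_gaugeTransformZd_sub_le hL hd U hU hg hε₀ hsm h44 V c
    have hcomp : (v ∘ blockMap L) ∘ blockBase L = v := by
      funext y; simp [Function.comp_apply]
    rw [hcomp] at h
    exact h.trans (hV c)

end Region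

/-! ## § 5  p. 265: «A gauge transformation v of V induces the gauge transformation v of V⁽ᵏ⁾ and the transformation
B′ → R(v)B′»; the covariance of `Q̃` in (2.4) -/

section Fluctuation

variable {𝔸 : Type*} [NormedRing 𝔸] [NormedAlgebra ℂ 𝔸] [NormOneClass 𝔸] [CompleteSpace 𝔸] {L : ℕ}

/-- [cite: Balaban1987RG1, (2.16) p.269] «(R(u)B′)(b) = R(u(b₋))B′(b)»: the adjoint action of a gauge function on a
`𝔤`-valued (here `𝔸`-valued) bond field, `(R(v)B′)(b) = v(b₋) B′(b) v(b₋)⁻¹`. -/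
def rotB (v : (Fin d → ℤ) → 𝔸ˣ) (B' : ZdEdge d → 𝔸) : ZdEdge d → 𝔸 :=
  fun b => (v b.1 : 𝔸) * B' b * (((v b.1)⁻¹ : 𝔸ˣ) : 𝔸)

omit [NormedAlgebra ℂ 𝔸] [NormOneClass 𝔸] [CompleteSpace 𝔸] in
/-- [cite: Balaban1987RG1, (2.16) p.269] unfolding of `rotB`. -/
theorem rotB_apply (v : (Fin d → ℤ) → 𝔸ˣ) (B' : ZdEdge d → 𝔸) (b : ZdEdge d) :
    rotB v B' b = (v b.1 : 𝔸) * B' b * (((v b.1)⁻¹ : 𝔸ˣ) : 𝔸) := rfl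

omit [NormOneClass 𝔸] in
/-- **p. 265 «A gauge transformation v of V induces the gauge transformation v of V⁽ᵏ⁾ and the transformation
B′ → R(v)B′»**: in the variables `V = V′V⁽ᵏ⁾`, `V′ = exp(iB′)` bondwise (`B12AverageCorridor267.pert`),
transforming `V⁽ᵏ⁾ ↦ (V⁽ᵏ⁾)^v` and `B′ ↦ R(v)B′` IS transforming `V ↦ V^v`:
`(V′V⁽ᵏ⁾)^v = exp(iR(v)B′)·(V⁽ᵏ⁾)^v` (`exp` of a conjugate is the conjugate of `exp`). [cite: Balaban1987RG1, p.265] -/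
theorem gaugeTransformZd_pert (v : (Fin d → ℤ) → 𝔸ˣ) (B' : ZdEdge d → 𝔸) (Vk : ZdEdge d → 𝔸ˣ) :
    gaugeTransformZd v (B12AverageCorridor267.pert B' Vk) = B12AverageCorridor267.pert (rotB v B') (gaugeTransformZd v Vk) := by
  funext b
  simp only [gaugeTransformZd, B12AverageCorridor267.pert_apply, rotB_apply]
  rw [show Complex.I • ((v b.1 : 𝔸) * B' b * (((v b.1)⁻¹ : 𝔸ˣ) : 𝔸))
      = (v b.1 : 𝔸) * (Complex.I • B' b) * (((v b.1)⁻¹ : 𝔸ˣ) : 𝔸) by rw [mul_smul_comm, smul_mul_assoc],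
    expU_conj]
  group

/-- **COVARIANCE OF `Q̃` IN (2.4)** («M(V′V⁽ᵏ⁾)(M(V⁽ᵏ⁾))⁻¹ = exp iQ̃(B′)»): for a `U1`-valued `v`, when the off-axis
(0.12) loops of `V⁽ᵏ⁾` and of `V′V⁽ᵏ⁾` and the quotient `M(V′V⁽ᵏ⁾)M(V⁽ᵏ⁾)⁻¹` lie in the domain `‖· − 1‖ < 1` of the
logarithm (B′ «restricted to a sufficiently small neighborhood of 0», p. 265), `Q̃_{(V⁽ᵏ⁾)^v}(R(v)B′)(c) =
v(L c₋) Q̃_{V⁽ᵏ⁾}(B′)(c) v(L c₋)⁻¹` — the expression under the `δ`-function of (2.1) is covariant.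
[cite: Balaban1987RG1, (2.4) p.266] -/
theorem Qtilde_gaugeTransformZd (hL : 0 < L) {v : (Fin d → ℤ) → 𝔸ˣ} (hv : ∀ z, v z ∈ U1 𝔸)
    (B' : ZdEdge d → 𝔸) (Vk : ZdEdge d → 𝔸ˣ) (c : ZdEdge d)
    (hW : ∀ x ∈ offAxis L c, ‖((loopW L (fun U : ZdEdge d → 𝔸ˣ => Tavg L U) Vk c x : 𝔸ˣ) : 𝔸) - 1‖ < 1)
    (hW' : ∀ x ∈ offAxis L c,
      ‖((loopW L (fun U : ZdEdge d → 𝔸ˣ => Tavg L U) (B12AverageCorridor267.pert B' Vk) c x : 𝔸ˣ) : 𝔸) - 1‖ < 1)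
    (hQ : ‖((avgBar L (B12AverageCorridor267.pert B' Vk) c * (avgBar L Vk c)⁻¹ : 𝔸ˣ) : 𝔸) - 1‖ < 1) :
    B12AverageCorridor267.Qtilde L (fun U : ZdEdge d → 𝔸ˣ => Tavg L U) (gaugeTransformZd v Vk) (rotB v B') c
      = (v (blockBase L c.1) : 𝔸) * B12AverageCorridor267.Qtilde L (fun U : ZdEdge d → 𝔸ˣ => Tavg L U) Vk B' c
          * (((v (blockBase L c.1))⁻¹ : 𝔸ˣ) : 𝔸) := by
  unfold B12AverageCorridor267.Qtilde
  have h1 : avgM L (fun U : ZdEdge d → 𝔸ˣ => Tavg L U) (B12AverageCorridor267.pert (rotB v B') (gaugeTransformZd v Vk)) c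
      = v (blockBase L c.1) * avgBar L (B12AverageCorridor267.pert B' Vk) c
          * (v (blockBase L (c.1 + Pi.single c.2 1)))⁻¹ := by
    rw [← gaugeTransformZd_pert]
    exact avgBar_gaugeTransformZd_of_loops hL _ hv c hW'
  have h2 : avgM L (fun U : ZdEdge d → 𝔸ˣ => Tavg L U) (gaugeTransformZd v Vk) c
      = v (blockBase L c.1) * avgBar L Vk c * (v (blockBase L (c.1 + Pi.single c.2 1)))⁻¹ :=
    avgBar_gaugeTransformZd_of_loops hL _ hv c hW
  rw [h1, h2]
  have h3 : v (blockBase L c.1) * avgBar L (B12AverageCorridor267.pert B' Vk) c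
        * (v (blockBase L (c.1 + Pi.single c.2 1)))⁻¹
      * (v (blockBase L c.1) * avgBar L Vk c * (v (blockBase L (c.1 + Pi.single c.2 1)))⁻¹)⁻¹
      = v (blockBase L c.1) * (avgBar L (B12AverageCorridor267.pert B' Vk) c * (avgBar L Vk c)⁻¹)
        * (v (blockBase L c.1))⁻¹ := by group
  rw [h3, Units.val_mul, Units.val_mul, mlog_units_conj (hv _) hQ, mul_smul_comm, smul_mul_assoc]
  rfl

end Fluctuation

end Literature.MathematicalPhysics.QuantumFieldTheory.Balaban1983to89.B12Average012Covariance

end
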